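/-
Origin: expansion seat `planner-pub-hodgecm-pv10-0`, handover 2026-08-18 (`HOME/pub-hodgecm-pv10/lean/Pv10/IdeleNormSurjective.lean`, md5 2f3a65c8, 102 lines);
landed by the gen-6 packager in gate run 22 as `HodgeCM/PerL34/IdeleNormSurjective.lean` (import ^import Pv[0-9]+\.→import HodgeCM.PerL34. ×2).
-/
/-
# Surjectivity of the idele norm onto `ℝ_{>0}` (N15 / D3)

WIP module `Pv10.IdeleNormSurjective` (pub-hodgecm-pv10); intended landing
`HodgeCM/PerL34/IdeleNormSurjective.lean`.

PerL v5 §3.2, tex ll. 310–311 (node N15): properness of `ι : C_{L₀} → C_L` is obtained from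
"norm-one classes are compact and `|·|_L = |·|²_{L₀}`" — via `ProperCriterion.isProperMap_of_norms`,
whose hypotheses include that the norm `C_K → ℝ_{>0}` is SURJECTIVE with compact kernel.  This file
proves the surjectivity half in the kernel: for every `t > 0` there is a positive-real idele at
infinity (all components equal to `t^{1/[K:ℚ]}`) of idele norm `t` (`exists_posRealUnits_norm_eq`,
using Mathlib's `∑_v mult v = [K:ℚ]`), hence `classNorm K` takes every positive value, already on
the image of the positive reals (`exists_classNorm_eq_of_pos`).  No PerL/QW8/2001 statement is used.
-/
import Summits.HodgeConjecture.HodgeCM.PerL34.IdeleNorm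
import Summits.HodgeConjecture.HodgeCM.PerL34.PolarDecomposition
import Mathlib.Analysis.SpecialFunctions.Pow.Real

/-! PORT of `HodgeCM/PerL34/IdeleNormSurjective.lean` (HodgeCMPerL run 82) — verbatim mechanical port; provenance in the PORT header line. -/

set_option autoImplicit false

noncomputable section

open Topology Filter Set Function

namespace NumberField

open InfinitePlace InfiniteAdeleRing

variable (K : Type*) [Field K] [NumberField K]

omit [NumberField K] in
/-- A unit of `K_∞` all of whose components map to the positive real `r` under the place
embeddings. -/
theorem exists_posRealUnits_forall_eq (r : ℝ) (hr : 0 < r) :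
    ∃ u : (InfiniteAdeleRing K)ˣ, u ∈ posRealUnits K ∧
      ∀ v : InfinitePlace K, ‖((u : InfiniteAdeleRing K) v)‖ = r := by
  choose x hx using fun v : InfinitePlace K => exists_extensionEmbedding_eq_ofReal K v r
  have hx0 : ∀ v, x v ≠ 0 := by
    intro v h
    have h1 := hx v
    rw [h, map_zero] at h1
    exact hr.ne' (by exact_mod_cast h1.symm)
  let a : InfiniteAdeleRing K := fun v => x v
  have ha : IsUnit a := Pi.isUnit_iff.mpr fun v => (hx0 v).isUnit
  refine ⟨ha.unit, fun v => ⟨r, hr, ?_⟩, fun v => ?_⟩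
  · show InfinitePlace.Completion.extensionEmbedding v (a v) = (r : ℂ)
    exact hx v
  · show ‖a v‖ = r
    rw [← norm_extensionEmbedding K v (a v), show InfinitePlace.Completion.extensionEmbedding v (a v) = (r : ℂ) from hx v,
      Complex.norm_real, Real.norm_eq_abs, abs_of_pos hr]

/-- **Every positive real is the archimedean norm of a positive-real idele at infinity.** -/
theorem exists_posRealUnits_norm_eq (t : ℝ) (ht : 0 < t) :
    ∃ u : (InfiniteAdeleRing K)ˣ, u ∈ posRealUnits K ∧ ‖(u : InfiniteAdeleRing K)‖ = t := by
  set n : ℕ := Module.finrank ℚ K with hn_def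
  have hn : n ≠ 0 := Module.finrank_pos.ne'
  set r : ℝ := t ^ (n⁻¹ : ℝ) with hr_def
  have hr : 0 < r := Real.rpow_pos_of_pos ht _
  obtain ⟨u, hu, hnorm⟩ := exists_posRealUnits_forall_eq K r hr
  refine ⟨u, hu, ?_⟩
  rw [norm_def]
  simp only [hnorm]
  rw [Finset.prod_pow_eq_pow_sum, sum_mult_eq, ← hn_def, hr_def]
  exact Real.rpow_inv_natCast_pow ht.le hn

/-- The idele norm takes every positive value (on `K_∞^× ⊂ 𝔸_K^×`). -/
theorem exists_ideleNorm_eq_of_pos (t : ℝ) (ht : 0 < t) :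
    ∃ u : (InfiniteAdeleRing K)ˣ, u ∈ posRealUnits K ∧ ideleNorm K (infUnitsToIdele K u) = t := by
  obtain ⟨u, hu, h⟩ := exists_posRealUnits_norm_eq K t ht
  exact ⟨u, hu, by rw [ideleNorm_infUnitsToIdele, h]⟩

/-- **The class norm `C_K → ℝ_{>0}` is onto**, already on the image of the positive-real ideles at
infinity. -/
theorem exists_classNorm_eq_of_pos (t : ℝ) (ht : 0 < t) :
    ∃ c : IdeleClassGroup K, c ∈ (posRealToClass K).range ∧ (classNorm K c : ℝ) = t := by
  obtain ⟨u, hu, h⟩ := exists_ideleNorm_eq_of_pos K t ht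
  refine ⟨infUnitsToClass K u, ⟨⟨u, hu⟩, rfl⟩, ?_⟩
  rw [show infUnitsToClass K u = QuotientGroup.mk (infUnitsToIdele K u) from rfl, classNorm_mk,
    coe_ideleNormUnits, h]

/-- (Ported verbatim from the HodgeCMPerL package; no docstring in the source.) -/
theorem classNorm_surjective_onto_pos :
    Set.range (fun c : IdeleClassGroup K => (classNorm K c : ℝ)) = Set.Ioi 0 := by
  ext t
  constructor
  · rintro ⟨c, rfl⟩
    exact coe_classNorm_pos K c
  · intro ht
    obtain ⟨c, -, hc⟩ := exists_classNorm_eq_of_pos K t ht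
    exact ⟨c, hc⟩

/-- `C_K = (positive reals) · C¹_K`: every idele class is a positive-real class times a norm-one
class. -/
theorem exists_posReal_mul_normOne_class (c : IdeleClassGroup K) :
    ∃ p ∈ (posRealToClass K).range, ∃ c₁ ∈ normOneIdeleClasses K, c = p * c₁ := by
  obtain ⟨p, hp, hpc⟩ := exists_classNorm_eq_of_pos K (classNorm K c : ℝ) (coe_classNorm_pos K c)
  refine ⟨p, hp, p⁻¹ * c, ?_, by rw [mul_inv_cancel_left]⟩
  rw [mem_normOneIdeleClasses_iff, map_mul, map_inv, Units.val_mul, Units.val_inv_eq_inv_val, hpc,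
    inv_mul_cancel₀ (coe_classNorm_pos K c).ne']

end NumberField

end
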